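import Literature.Computability.Complexity.ProductSpaceRandomization
import Literature.Computability.Complexity.HypercontractivityP2
import HarnessLib

/-!
# Bourgain's sharp threshold theorem (O'Donnell's form, explicit constants)

R. O'Donnell, *Analysis of Boolean Functions* (CUP 2014), §10.5, "Bourgain's Sharp Threshold
Theorem" and its source **Theorem 10.47** (J. Bourgain, appendix to E. Friedgut, J. Amer. Math.
Soc. 12 (1999), Proposition 1), in the uniform finite product-space setting of
`ProductSpaceDecomposition.lean` / `ProductSpaceRandomization.lean`, with all constants explicit:

for a `±1`-valued `f` on `ι → Ω` with `I[f] ≤ K` and `Var[f] ≥ v₀ > 0` there are `τ = τ(K, v₀) > 0`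
and `L = ⌈4K/v₀⌉` such that with probability at least `τ` a uniform `x` admits a set `T` of at
most `L` coordinates whose restriction `x_T` is a `τ`-booster of a definite sign
(`f^{⊆T}(x) ≥ E f + τ` with probability `≥ τ`, or `f^{⊆T}(x) ≤ E f - τ` with probability `≥ τ`).

The proof is O'Donnell's: the "Markov" tail bound (Prop. 3.2), inequality (10.24) through
**Lemma 10.48** (uniform-cube `(4/3,2)`-hypercontractivity `stability_le_norm_rpow` of
`HypercontractivityP2.lean` applied to the randomization `r ↦ T_{(2/5)r}(L_i f)(x)`, then
un-randomization `avg_rpow_noiseT_le` and `‖L_i f‖_{4/3}^{4/3} ≤ Inf_i[f]`), inequality (10.25)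
through (10.26)–(10.28) (Markov, Cauchy–Schwarz, un-randomization at `q = 4`), and the extraction
of a booster from a large `|f^{=S}(x)|` (last page of §10.5). Constants: notable threshold
`δ³ = 10^{-6L}` (`c = 10⁶`), "too big" at `B = (1.6·10^{10})^L` (`C = 16000 c`).

## Results (all proved)

* `hc_walsh_sum`, `parseval_walsh_sum` — `(4/3,2)`-hypercontractivity and Parseval for Walsh sums
  `∑_S a_S χ_S` over a general finite index type (transport from `Fin m`);
* `level_energy_outside_notable_le` — (10.24): `E_x ∑_{|S|≤L, S ⊄ J'_x} f^{=S}(x)² ≤ 20^L δ I[f]`;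
* `avg_indicator_big_le` (10.27), `avg_sq_lowlevel_energy_le` (10.28), `energy_big_le` (10.25);
* `energy_outside_family_le` — Theorem 10.47 in energy form;
* `bourgain_sharp_threshold` — **Bourgain's sharp threshold theorem** with explicit `τ(K,v₀)`,
  `L = ⌈4K/v₀⌉`.

## References

* R. O'Donnell, *Analysis of Boolean Functions*, CUP 2014, §10.5 (Def. 10.46, Bourgain's Sharp
  Threshold Theorem, Thm. 10.47, Lemma 10.48, (10.23)–(10.29)) [ODonnell2014].
* J. Bourgain, *On sharp thresholds of monotone properties*, appendix to E. Friedgut, J. Amer.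
  Math. Soc. 12 (1999) 1017–1054, Proposition 1 [Friedgut1999].
-/

noncomputable section

namespace Literature.Computability.Complexity

namespace ProductSpace

open Finset Real Literature.Probability.RandomGraphs.LowDegree
  Literature.Computability.Complexity.LowDegree

variable {ι Ω : Type*} [Fintype ι] [DecidableEq ι] [Fintype Ω] [Nonempty Ω]

/-! ### Walsh sums over a general finite index type -/

omit [Fintype ι] [DecidableEq ι] [Fintype Ω] [Nonempty Ω] in
/-- A character reindexed along an equivalence. [folklore] -/
theorem walsh_map_equiv {m : ℕ} (e : ι ≃ Fin m) (S : Finset ι) (x : Fin m → Bool) :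
    walsh (S.map e.toEmbedding) x = walsh S (x ∘ e) := by
  unfold walsh
  rw [Finset.prod_map]
  rfl

omit [Fintype Ω] [Nonempty Ω] in
/-- **`(4/3, 2)`-hypercontractivity for Walsh sums** over any finite index type:
`∑_S (1/3)^{|S|} a_S² ≤ (E_b |∑_S a_S χ_S(b)|^{4/3})^{3/2}` (O'Donnell 2014, Ch. 9,
(p,2)-Hypercontractivity Theorem with `p = 4/3`; transported from `stability_le_norm_rpow`).
[cite: ODonnell2014, Ch. 9 ((p,2)-Hypercontractivity Theorem)] -/
theorem hc_walsh_sum (a : Finset ι → ℝ) :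
    ∑ S, (1 / 3 : ℝ) ^ S.card * a S ^ 2 ≤
      (avg fun b : ι → Bool => |∑ S, a S * walsh S b| ^ (4 / 3 : ℝ)) ^ (3 / 2 : ℝ) := by
  set m := Fintype.card ι
  set e : ι ≃ Fin m := Fintype.equivFin ι
  set fe : Finset ι ≃ Finset (Fin m) := e.finsetCongr with hfe
  set c : Finset (Fin m) → ℝ := fun T => a (fe.symm T) with hc
  set G' : (Fin m → Bool) → ℝ := fun x => ∑ T, c T * walsh T x with hG'
  -- `G' x = ∑_S a_S χ_S (x ∘ e)`
  have hG'eq : ∀ x : Fin m → Bool, G' x = ∑ S, a S * walsh S (x ∘ e) := by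
    intro x
    show ∑ T, c T * walsh T x = _
    rw [← Equiv.sum_comp fe (fun T => c T * walsh T x)]
    refine Finset.sum_congr rfl fun S _ => ?_
    rw [hc]
    simp only [Equiv.symm_apply_apply]
    rw [hfe, Equiv.finsetCongr_apply, walsh_map_equiv]
  -- the tree's hypercontractivity for `G'`
  have hHC := stability_le_norm_rpow (p := 4 / 3) (by norm_num) (by norm_num) G'
  have hcoef : ∀ T, cubeFourierCoeff G' T = c T := fun T => cubeFourierCoeff_sum_mul_walsh c T
  simp only [hcoef] at hHC
  have hp1 : (4 / 3 : ℝ) - 1 = 1 / 3 := by norm_num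
  have hp2 : (2 : ℝ) / (4 / 3) = 3 / 2 := by norm_num
  rw [hp1, hp2] at hHC
  -- reindex the left side
  have hL : ∑ S, (1 / 3 : ℝ) ^ S.card * a S ^ 2 = ∑ T, (1 / 3 : ℝ) ^ T.card * c T ^ 2 := by
    rw [← Equiv.sum_comp fe]
    refine Finset.sum_congr rfl fun S _ => ?_
    rw [hc]
    simp only [Equiv.symm_apply_apply]
    rw [hfe, Equiv.finsetCongr_apply, Finset.card_map]
  rw [hL]
  refine hHC.trans (le_of_eq ?_)
  congr 1
  -- the right side is an average over `ι → Bool`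
  have hcard : (Fintype.card (Fin m → Bool) : ℝ) = (2 : ℝ) ^ m := by
    simp [Fintype.card_bool, Fintype.card_fin]
  rw [← hcard, ← avg_def (fun x : Fin m → Bool => |G' x| ^ (4 / 3 : ℝ))]
  set Φ : (Fin m → Bool) ≃ (ι → Bool) := e.symm.arrowCongr (Equiv.refl Bool) with hΦ
  rw [← avg_comp_equiv Φ (fun b : ι → Bool => |∑ S, a S * walsh S b| ^ (4 / 3 : ℝ))]
  refine avg_congr fun x => ?_
  rw [hG'eq x]
  rfl

omit [Fintype Ω] [Nonempty Ω] in
/-- **Parseval for Walsh sums** over any finite index type: `E_b (∑_S a_S χ_S(b))² = ∑_S a_S²`.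
[cite: ODonnell2014, §1.4] -/
theorem parseval_walsh_sum (a : Finset ι → ℝ) :
    avg (fun b : ι → Bool => (∑ S, a S * walsh S b) ^ 2) = ∑ S, a S ^ 2 := by
  set m := Fintype.card ι
  set e : ι ≃ Fin m := Fintype.equivFin ι
  set fe : Finset ι ≃ Finset (Fin m) := e.finsetCongr with hfe
  set c : Finset (Fin m) → ℝ := fun T => a (fe.symm T) with hc
  set G' : (Fin m → Bool) → ℝ := fun x => ∑ T, c T * walsh T x with hG'
  have hG'eq : ∀ x : Fin m → Bool, G' x = ∑ S, a S * walsh S (x ∘ e) := by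
    intro x
    show ∑ T, c T * walsh T x = _
    rw [← Equiv.sum_comp fe (fun T => c T * walsh T x)]
    refine Finset.sum_congr rfl fun S _ => ?_
    rw [hc]
    simp only [Equiv.symm_apply_apply]
    rw [hfe, Equiv.finsetCongr_apply, walsh_map_equiv]
  have hP := sum_cubeFourierCoeff_sq G'
  have hcoef : ∀ T, cubeFourierCoeff G' T = c T := fun T => cubeFourierCoeff_sum_mul_walsh c T
  simp only [hcoef] at hP
  have hL : ∑ S, a S ^ 2 = ∑ T, c T ^ 2 := by
    rw [← Equiv.sum_comp fe]
    refine Finset.sum_congr rfl fun S _ => ?_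
    rw [hc]
    simp only [Equiv.symm_apply_apply]
  rw [hL, hP]
  have hcard : (Fintype.card (Fin m → Bool) : ℝ) = (2 : ℝ) ^ m := by
    simp [Fintype.card_bool, Fintype.card_fin]
  rw [← hcard, ← avg_def (fun x : Fin m → Bool => G' x ^ 2)]
  set Φ : (Fin m → Bool) ≃ (ι → Bool) := e.symm.arrowCongr (Equiv.refl Bool) with hΦ
  rw [← avg_comp_equiv Φ (fun b : ι → Bool => (∑ S, a S * walsh S b) ^ 2)]
  refine avg_congr fun x => ?_
  rw [hG'eq x]
  rfl

/-! ### The randomizing sign vectors `(2/5)·(±1, …, ±1)` -/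

omit [Fintype ι] [DecidableEq ι] [Fintype Ω] [Nonempty Ω] in
/-- The vector `r_b = (2/5)·χ(b)`, `(r_b)_j = (2/5)(-1)^{b_j}`. [cite: ODonnell2014, Theorem 10.44] -/
def sgnVec (b : ι → Bool) (j : ι) : ℝ := 2 / 5 * sgn (b j)

omit [Fintype ι] [DecidableEq ι] [Fintype Ω] [Nonempty Ω] in
/-- Every coordinate of `r_b` is admissible for Theorem 10.44 (`2/5 ∈ [0,1]` or `-2/5`).
[cite: ODonnell2014, Theorem 10.44] -/
theorem sgnVec_adm (b : ι → Bool) (j : ι) :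
    (0 ≤ sgnVec b j ∧ sgnVec b j ≤ 1) ∨ sgnVec b j = -2 / 5 := by
  unfold sgnVec
  cases b j
  · left; simp [sgn]; norm_num
  · right; simp [sgn]; norm_num

omit [Fintype ι] [DecidableEq ι] [Fintype Ω] [Nonempty Ω] in
/-- `r_b^S = (2/5)^{|S|} χ_S(b)`. [cite: ODonnell2014, §10.4] -/
theorem prod_sgnVec (b : ι → Bool) (S : Finset ι) :
    ∏ j ∈ S, sgnVec b j = (2 / 5 : ℝ) ^ S.card * walsh S b := by
  unfold sgnVec walsh
  rw [Finset.prod_mul_distrib, Finset.prod_const]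

/-- The randomization of `T_{2/5} L_i f` at `x`: `T_{r_b}(L_i f)(x) = ∑_{S ∋ i} (2/5)^{|S|} χ_S(b) f^{=S}(x)`.
[cite: ODonnell2014, Lemma 10.48] -/
theorem noiseT_sgnVec_coordL (b : ι → Bool) (i : ι) (f : (ι → Ω) → ℝ) (x : ι → Ω) :
    noiseT (sgnVec b) (coordL i f) x =
      ∑ S, (if i ∈ S then (2 / 5 : ℝ) ^ S.card * pure S f x else 0) * walsh S b := by
  rw [noiseT_coordL]
  refine Finset.sum_congr rfl fun S _ => ?_
  rw [prod_sgnVec]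
  split_ifs <;> ring

/-- The randomization of `T_{2/5} (f - E f)` at `x`:
`T_{r_b}(f - Ef)(x) = ∑_{S ≠ ∅} (2/5)^{|S|} χ_S(b) f^{=S}(x)`. [cite: ODonnell2014, (10.28)] -/
theorem noiseT_sgnVec_sub_avg (b : ι → Bool) (f : (ι → Ω) → ℝ) (x : ι → Ω) :
    noiseT (sgnVec b) (fun y => f y - avg f) x =
      ∑ S, (if S = ∅ then 0 else (2 / 5 : ℝ) ^ S.card * pure S f x) * walsh S b := by
  rw [noiseT_sub_avg]
  refine Finset.sum_congr rfl fun S _ => ?_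
  rw [prod_sgnVec]
  split_ifs <;> ring

/-! ### Lemma 10.48 and inequality (10.24) -/

/-- **Lemma 10.48 with the first steps of (10.24)** (O'Donnell 2014): fix `x` and a coordinate `i`
that is NOT notable, `∑_{S ∋ i} f^{=S}(x)² ≤ δ³`. Then
`∑_{S ∋ i, |S| ≤ L} f^{=S}(x)² ≤ 20^L · δ · E_b |T_{r_b}(L_i f)(x)|^{4/3}`
(hypercontractivity `(4/3,2)` on the cube for the randomization, whose `2`-norm is `≤ δ^{3/2}`).
[cite: ODonnell2014, Lemma 10.48] -/
theorem local_level_energy_le (f : (ι → Ω) → ℝ) (x : ι → Ω) (i : ι) (L : ℕ) {δ : ℝ} (hδ : 0 ≤ δ)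
    (hnot : ∑ S, (if i ∈ S then pure S f x ^ 2 else 0) ≤ δ ^ 3) :
    ∑ S, (if i ∈ S ∧ S.card ≤ L then pure S f x ^ 2 else 0) ≤
      20 ^ L * δ * avg (fun b : ι → Bool => |noiseT (sgnVec b) (coordL i f) x| ^ (4 / 3 : ℝ)) := by
  set a : Finset ι → ℝ := fun S => if i ∈ S then (2 / 5 : ℝ) ^ S.card * pure S f x else 0 with ha
  set M : ℝ := avg (fun b : ι → Bool => |noiseT (sgnVec b) (coordL i f) x| ^ (4 / 3 : ℝ)) with hM
  have hMeq : M = avg (fun b : ι → Bool => |∑ S, a S * walsh S b| ^ (4 / 3 : ℝ)) :=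
    avg_congr fun b => by rw [noiseT_sgnVec_coordL]
  have hM0 : 0 ≤ M := avg_nonneg fun b => Real.rpow_nonneg (abs_nonneg _) _
  -- (ii)+(iii): `∑ (1/3)^|S| a_S² ≤ M^{3/2} ≤ ∑ a_S² ≤ δ³`
  have hHC : ∑ S, (1 / 3 : ℝ) ^ S.card * a S ^ 2 ≤ M ^ (3 / 2 : ℝ) := by
    rw [hMeq]; exact hc_walsh_sum a
  have hPar : M ^ (3 / 2 : ℝ) ≤ δ ^ 3 := by
    calc M ^ (3 / 2 : ℝ) ≤ avg (fun b : ι → Bool => (∑ S, a S * walsh S b) ^ 2) := by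
          rw [hMeq]; exact avg_rpow_four_thirds_le _
      _ = ∑ S, a S ^ 2 := parseval_walsh_sum a
      _ ≤ ∑ S, (if i ∈ S then pure S f x ^ 2 else 0) := by
          refine Finset.sum_le_sum fun S _ => ?_
          rw [ha]
          simp only
          split_ifs with hi
          · rw [mul_pow]
            have h1 : ((2 / 5 : ℝ) ^ S.card) ^ 2 ≤ 1 := by
              rw [← pow_mul]; exact pow_le_one₀ (by norm_num) (by norm_num)
            have h2 : 0 ≤ pure S f x ^ 2 := sq_nonneg _
            nlinarith
          · simp
      _ ≤ δ ^ 3 := hnot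
  -- hence `M^{1/2} ≤ δ` and `M^{3/2} ≤ δ M`
  have hM12 : M ^ (1 / 2 : ℝ) ≤ δ := by
    have h := Real.rpow_le_rpow (Real.rpow_nonneg hM0 _) hPar (show (0 : ℝ) ≤ 1 / 3 by norm_num)
    rw [← Real.rpow_mul hM0, show ((3 : ℝ)) = ((3 : ℕ) : ℝ) by norm_num, ← Real.rpow_natCast,
      ← Real.rpow_mul hδ] at h
    norm_num at h
    exact h
  have hM32 : M ^ (3 / 2 : ℝ) ≤ δ * M := by
    have e : M ^ (3 / 2 : ℝ) = M ^ (1 / 2 : ℝ) * M := by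
      rw [show (3 / 2 : ℝ) = 1 / 2 + 1 by norm_num, Real.rpow_add' hM0 (by norm_num), Real.rpow_one]
    rw [e]
    exact mul_le_mul_of_nonneg_right hM12 hM0
  -- (iv): termwise `[i ∈ S, |S| ≤ L] P ≤ 20^L (1/3)^|S| a_S²`
  have hterm : ∀ S, (if i ∈ S ∧ S.card ≤ L then pure S f x ^ 2 else 0) ≤
      20 ^ L * ((1 / 3 : ℝ) ^ S.card * a S ^ 2) := by
    intro S
    rw [ha]
    simp only
    by_cases hi : i ∈ S
    · by_cases hL : S.card ≤ L
      · rw [if_pos ⟨hi, hL⟩, if_pos hi, mul_pow, ← pow_mul]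
        -- `1 ≤ 20^L (1/3)^s (2/5)^{2s}` for `s ≤ L`
        have h0 : 0 ≤ pure S f x ^ 2 := sq_nonneg _
        have hkey : (1 : ℝ) ≤ 20 ^ L * ((1 / 3 : ℝ) ^ S.card * (2 / 5 : ℝ) ^ (S.card * 2)) := by
          obtain ⟨d, hd⟩ := Nat.exists_eq_add_of_le hL
          have e1 : ((1 / 3 : ℝ) ^ S.card * (2 / 5 : ℝ) ^ (S.card * 2)) = (1 / 3 * (2 / 5) ^ 2 : ℝ) ^ S.card := by
            rw [pow_mul', ← mul_pow]
          rw [e1, hd, pow_add]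
          calc (1 : ℝ) ≤ (20 * (1 / 3 * (2 / 5) ^ 2 : ℝ)) ^ S.card * 20 ^ d :=
                one_le_mul_of_one_le_of_one_le (one_le_pow₀ (by norm_num)) (one_le_pow₀ (by norm_num))
            _ = 20 ^ S.card * 20 ^ d * (1 / 3 * (2 / 5) ^ 2 : ℝ) ^ S.card := by rw [mul_pow]; ring
        calc pure S f x ^ 2 = 1 * pure S f x ^ 2 := (one_mul _).symm
          _ ≤ (20 ^ L * ((1 / 3 : ℝ) ^ S.card * (2 / 5 : ℝ) ^ (S.card * 2))) * pure S f x ^ 2 :=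
              mul_le_mul_of_nonneg_right hkey h0
          _ = 20 ^ L * ((1 / 3 : ℝ) ^ S.card * ((2 / 5 : ℝ) ^ (S.card * 2) * pure S f x ^ 2)) := by ring
      · rw [if_neg (fun h => hL h.2)]
        positivity
    · rw [if_neg (fun h => hi h.1), if_neg hi]
      simp
  calc ∑ S, (if i ∈ S ∧ S.card ≤ L then pure S f x ^ 2 else 0)
      ≤ ∑ S, 20 ^ L * ((1 / 3 : ℝ) ^ S.card * a S ^ 2) := Finset.sum_le_sum fun S _ => hterm S
    _ = 20 ^ L * ∑ S, (1 / 3 : ℝ) ^ S.card * a S ^ 2 := by rw [Finset.mul_sum]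
    _ ≤ 20 ^ L * M ^ (3 / 2 : ℝ) := mul_le_mul_of_nonneg_left hHC (by positivity)
    _ ≤ 20 ^ L * (δ * M) := mul_le_mul_of_nonneg_left hM32 (by positivity)
    _ = 20 ^ L * δ * M := by ring

/-- The "notable coordinates" of `x` at threshold `δ³`:
`J'_x = {j : ∑_{S ∋ j} f^{=S}(x)² ≥ δ³}` (O'Donnell 2014, proof of Thm. 10.47).
[cite: ODonnell2014, Theorem 10.47] -/
def notable (f : (ι → Ω) → ℝ) (δ : ℝ) (x : ι → Ω) : Finset ι :=
  Finset.univ.filter fun j => δ ^ 3 ≤ ∑ S : Finset ι, (if j ∈ S then pure S f x ^ 2 else 0)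

/-- Un-randomization of the `4/3`-moments summed over coordinates:
`∑_i E_x E_b |T_{r_b}(L_i f)(x)|^{4/3} ≤ I[f]` for `±1`-valued `f` (O'Donnell 2014, the last three
steps of (10.24): Theorem 10.35/10.44 and Exercise 8.10(b)). [cite: ODonnell2014, (10.24)] -/
theorem sum_avg_avg_rpow_noiseT_coordL_le (f : (ι → Ω) → ℝ) (hf : ∀ x, f x = 1 ∨ f x = -1) :
    ∑ i, avg (fun x : ι → Ω => avg (fun b : ι → Bool =>
      |noiseT (sgnVec b) (coordL i f) x| ^ (4 / 3 : ℝ))) ≤ totalInfl f := by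
  unfold totalInfl
  refine Finset.sum_le_sum fun i _ => ?_
  calc avg (fun x : ι → Ω => avg (fun b : ι → Bool => |noiseT (sgnVec b) (coordL i f) x| ^ (4 / 3 : ℝ)))
      = avg (fun b : ι → Bool => avg (fun x : ι → Ω => |noiseT (sgnVec b) (coordL i f) x| ^ (4 / 3 : ℝ))) := by
        rw [← avg_prod (fun (x : ι → Ω) (b : ι → Bool) => |noiseT (sgnVec b) (coordL i f) x| ^ (4 / 3 : ℝ)),
          avg_prod_comm (fun (x : ι → Ω) (b : ι → Bool) => |noiseT (sgnVec b) (coordL i f) x| ^ (4 / 3 : ℝ))]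
    _ ≤ avg (fun _b : ι → Bool => avg (fun x : ι → Ω => |coordL i f x| ^ (4 / 3 : ℝ))) :=
        avg_mono fun b => avg_rpow_noiseT_le (sgnVec_adm b) _
    _ = avg (fun x : ι → Ω => |coordL i f x| ^ (4 / 3 : ℝ)) := avg_const _
    _ ≤ infl i f := avg_rpow_coordL_le_infl i hf

/-- **Inequality (10.24)** (O'Donnell 2014, proof of Thm. 10.47): the level-`≤ L` energy carried by
sets not inside the notable coordinates is small,
`E_x ∑_{|S| ≤ L, S ⊄ J'_x} f^{=S}(x)² ≤ 20^L δ I[f]`. [cite: ODonnell2014, (10.24)] -/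
theorem level_energy_outside_notable_le (f : (ι → Ω) → ℝ) (hf : ∀ x, f x = 1 ∨ f x = -1)
    (L : ℕ) {δ : ℝ} (hδ : 0 ≤ δ) :
    avg (fun x : ι → Ω => ∑ S : Finset ι,
      (if S.card ≤ L ∧ ¬ S ⊆ notable f δ x then pure S f x ^ 2 else 0)) ≤
      20 ^ L * δ * totalInfl f := by
  -- pointwise in `x`
  have hpt : ∀ x : ι → Ω, ∑ S : Finset ι, (if S.card ≤ L ∧ ¬ S ⊆ notable f δ x then pure S f x ^ 2 else 0) ≤
      20 ^ L * δ * ∑ i, avg (fun b : ι → Bool => |noiseT (sgnVec b) (coordL i f) x| ^ (4 / 3 : ℝ)) := by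
    intro x
    -- (a) cover `S ⊄ J'` by its coordinates outside `J'`
    have ha : ∑ S : Finset ι, (if S.card ≤ L ∧ ¬ S ⊆ notable f δ x then pure S f x ^ 2 else 0) ≤
        ∑ i ∈ (notable f δ x)ᶜ, ∑ S : Finset ι, (if i ∈ S ∧ S.card ≤ L then pure S f x ^ 2 else 0) := by
      rw [Finset.sum_comm]
      refine Finset.sum_le_sum fun S _ => ?_
      split_ifs with h
      · obtain ⟨i, hiS, hiJ⟩ := Finset.not_subset.1 h.2
        have hmem : i ∈ (notable f δ x)ᶜ := Finset.mem_compl.2 hiJ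
        calc pure S f x ^ 2 = (if i ∈ S ∧ S.card ≤ L then pure S f x ^ 2 else 0) := by rw [if_pos ⟨hiS, h.1⟩]
          _ ≤ ∑ j ∈ (notable f δ x)ᶜ, (if j ∈ S ∧ S.card ≤ L then pure S f x ^ 2 else 0) := by
              apply Finset.single_le_sum (f := fun j => if j ∈ S ∧ S.card ≤ L then pure S f x ^ 2 else 0)
                (fun j _ => by positivity) hmem
      · exact Finset.sum_nonneg fun j _ => by positivity
    -- (b) each non-notable coordinate: Lemma 10.48
    have hb : ∀ i ∈ (notable f δ x)ᶜ, ∑ S : Finset ι, (if i ∈ S ∧ S.card ≤ L then pure S f x ^ 2 else 0) ≤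
        20 ^ L * δ * avg (fun b : ι → Bool => |noiseT (sgnVec b) (coordL i f) x| ^ (4 / 3 : ℝ)) := by
      intro i hi
      apply local_level_energy_le f x i L hδ
      have : ¬ (δ ^ 3 ≤ ∑ S : Finset ι, (if i ∈ S then pure S f x ^ 2 else 0)) := by
        intro h
        have : i ∈ notable f δ x := Finset.mem_filter.2 ⟨Finset.mem_univ _, h⟩
        exact (Finset.mem_compl.1 hi) this
      exact le_of_lt (not_le.1 this)
    calc _ ≤ _ := ha
      _ ≤ ∑ i ∈ (notable f δ x)ᶜ, 20 ^ L * δ *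
            avg (fun b : ι → Bool => |noiseT (sgnVec b) (coordL i f) x| ^ (4 / 3 : ℝ)) :=
          Finset.sum_le_sum hb
      _ ≤ ∑ i, 20 ^ L * δ * avg (fun b : ι → Bool => |noiseT (sgnVec b) (coordL i f) x| ^ (4 / 3 : ℝ)) := by
          apply Finset.sum_le_sum_of_subset_of_nonneg (Finset.subset_univ _)
          intro i _ _
          exact mul_nonneg (by positivity) (avg_nonneg fun b => Real.rpow_nonneg (abs_nonneg _) _)
      _ = _ := by rw [← Finset.mul_sum]
  calc _ ≤ avg (fun x : ι → Ω => 20 ^ L * δ *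
        ∑ i, avg (fun b : ι → Bool => |noiseT (sgnVec b) (coordL i f) x| ^ (4 / 3 : ℝ))) := avg_mono hpt
    _ = 20 ^ L * δ * ∑ i, avg (fun x : ι → Ω =>
        avg (fun b : ι → Bool => |noiseT (sgnVec b) (coordL i f) x| ^ (4 / 3 : ℝ))) := by
        rw [avg_mul_left, avg_finset_sum]
    _ ≤ 20 ^ L * δ * totalInfl f :=
        mul_le_mul_of_nonneg_left (sum_avg_avg_rpow_noiseT_coordL_le f hf) (by positivity)

/-! ### Inequality (10.25): the notable set is rarely too big -/

/-- `E_x ∑_j ∑_{S ∋ j} f^{=S}(x)² = I[f]`. [cite: ODonnell2014, Prop. 8.45] -/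
theorem avg_sum_sum_ite_eq_totalInfl (f : (ι → Ω) → ℝ) :
    avg (fun x : ι → Ω => ∑ j, ∑ S : Finset ι, (if j ∈ S then pure S f x ^ 2 else 0)) = totalInfl f := by
  rw [avg_finset_sum, totalInfl]
  refine Finset.sum_congr rfl fun j _ => ?_
  rw [avg_finset_sum, infl_eq_sum]
  refine Finset.sum_congr rfl fun S _ => ?_
  split_ifs
  · rw [one_mul]
  · rw [zero_mul]; exact avg_zero

/-- **(10.27)** (O'Donnell 2014): `P_x[|J'_x| ≥ B] ≤ I[f]/(B δ³)` (Markov twice).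
[cite: ODonnell2014, (10.27)] -/
theorem avg_indicator_big_le (f : (ι → Ω) → ℝ) {δ B : ℝ} (hδ : 0 < δ) (hB : 0 < B) :
    avg (fun x : ι → Ω => if B ≤ ((notable f δ x).card : ℝ) then (1 : ℝ) else 0) ≤
      totalInfl f / (B * δ ^ 3) := by
  have hδ3 : 0 < δ ^ 3 := pow_pos hδ 3
  -- `|J'_x| δ³ ≤ ∑_j ∑_{S ∋ j} P_x(S)`
  have hcard : ∀ x : ι → Ω, ((notable f δ x).card : ℝ) * δ ^ 3 ≤
      ∑ j, ∑ S : Finset ι, (if j ∈ S then pure S f x ^ 2 else 0) := by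
    intro x
    unfold notable
    rw [Finset.card_eq_sum_ones, Nat.cast_sum, Finset.sum_mul, Finset.sum_filter]
    refine Finset.sum_le_sum fun j _ => ?_
    split_ifs with h
    · simpa using h
    · exact Finset.sum_nonneg fun S _ => by positivity
  calc avg (fun x : ι → Ω => if B ≤ ((notable f δ x).card : ℝ) then (1 : ℝ) else 0)
      ≤ avg (fun x : ι → Ω => (∑ j, ∑ S : Finset ι, (if j ∈ S then pure S f x ^ 2 else 0)) / (B * δ ^ 3)) := by
        refine avg_mono fun x => ?_
        rw [le_div_iff₀ (mul_pos hB hδ3)]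
        split_ifs with h
        · calc (1 : ℝ) * (B * δ ^ 3) ≤ ((notable f δ x).card : ℝ) * δ ^ 3 := by nlinarith
            _ ≤ _ := hcard x
        · rw [zero_mul]; exact Finset.sum_nonneg fun j _ => Finset.sum_nonneg fun S _ => by positivity
    _ = totalInfl f / (B * δ ^ 3) := by
        rw [show (fun x : ι → Ω => (∑ j, ∑ S : Finset ι, (if j ∈ S then pure S f x ^ 2 else 0)) / (B * δ ^ 3)) =
          fun x => (∑ j, ∑ S : Finset ι, (if j ∈ S then pure S f x ^ 2 else 0)) * (1 / (B * δ ^ 3)) by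
          funext x; ring]
        rw [avg_mul_right, avg_sum_sum_ite_eq_totalInfl]; ring

/-- `E (f - Ef)² = Var f` and `E (f - E f)⁴ ≤ 4 Var f` for `±1`-valued `f`. [folklore] -/
theorem avg_pow_four_sub_avg_le (f : (ι → Ω) → ℝ) (hf : ∀ x, f x = 1 ∨ f x = -1) :
    avg (fun x : ι → Ω => (f x - avg f) ^ 4) ≤ 4 * variance f := by
  have hμ : |avg f| ≤ 1 := (abs_avg_le f).trans (avg_le_of_le fun x => by rcases hf x with h | h <;> simp [h])
  have hvar : avg (fun x : ι → Ω => (f x - avg f) ^ 2) = variance f := by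
    unfold variance
    have e : ∀ x, (f x - avg f) ^ 2 = f x ^ 2 - 2 * avg f * f x + avg f ^ 2 := fun x => by ring
    simp_rw [e]
    rw [avg_add, avg_sub, avg_const, avg_mul_left]; ring
  rw [← hvar]
  rw [← avg_mul_left]
  refine avg_mono fun x => ?_
  have hb : (f x - avg f) ^ 2 ≤ 4 := by
    have hμ' := abs_le.1 hμ
    rcases hf x with h | h <;> rw [h] <;> nlinarith
  nlinarith [sq_nonneg (f x - avg f)]

/-- **(10.28)** (O'Donnell 2014): `E_x (∑_{0<|S|≤L} f^{=S}(x)²)² ≤ 4·40^L·I[f]` — through the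
randomization of `T_{2/5}(f - Ef)`, Jensen on the cube, un-randomization at `q = 4`
(`avg_pow_four_noiseT_le`) and `|f - Ef| ≤ 2`. [cite: ODonnell2014, (10.28)] -/
theorem avg_sq_lowlevel_energy_le (f : (ι → Ω) → ℝ) (hf : ∀ x, f x = 1 ∨ f x = -1) (L : ℕ) :
    avg (fun x : ι → Ω => (∑ S : Finset ι, (if S ≠ ∅ ∧ S.card ≤ L then pure S f x ^ 2 else 0)) ^ 2) ≤
      4 * 40 ^ L * totalInfl f := by
  -- the randomization `H_x(b) = T_{r_b}(f - Ef)(x)` and its coefficients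
  set hc : (ι → Ω) → Finset ι → ℝ := fun x S => if S = ∅ then 0 else (2 / 5 : ℝ) ^ S.card * pure S f x
    with hhc
  have hH : ∀ (x : ι → Ω) (b : ι → Bool), noiseT (sgnVec b) (fun y => f y - avg f) x = ∑ S, hc x S * walsh S b :=
    fun x b => noiseT_sgnVec_sub_avg b f x
  -- pointwise: `Q_x ≤ (5/2)^{2L} E_b H_x²`
  have hQ : ∀ x : ι → Ω, ∑ S : Finset ι, (if S ≠ ∅ ∧ S.card ≤ L then pure S f x ^ 2 else 0) ≤
      (5 / 2 : ℝ) ^ (2 * L) * avg (fun b : ι → Bool => (∑ S, hc x S * walsh S b) ^ 2) := by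
    intro x
    rw [parseval_walsh_sum, Finset.mul_sum]
    refine Finset.sum_le_sum fun S _ => ?_
    rw [hhc]
    simp only
    by_cases hS : S = ∅
    · rw [if_neg (fun h => h.1 hS), if_pos hS]; simp
    · rw [if_neg hS]
      by_cases hL : S.card ≤ L
      · rw [if_pos ⟨hS, hL⟩, mul_pow, ← pow_mul]
        have h0 : 0 ≤ pure S f x ^ 2 := sq_nonneg _
        have hkey : (1 : ℝ) ≤ (5 / 2 : ℝ) ^ (2 * L) * (2 / 5 : ℝ) ^ (S.card * 2) := by
          obtain ⟨d, hd⟩ := Nat.exists_eq_add_of_le hL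
          rw [hd, pow_mul, pow_mul', pow_add]
          have e : ((5 / 2 : ℝ) ^ 2) ^ S.card * ((5 / 2 : ℝ) ^ 2) ^ d * ((2 / 5 : ℝ) ^ 2) ^ S.card =
              ((5 / 2 : ℝ) ^ 2 * (2 / 5) ^ 2) ^ S.card * ((5 / 2 : ℝ) ^ 2) ^ d := by rw [mul_pow]; ring
          rw [e, show ((5 / 2 : ℝ) ^ 2 * (2 / 5) ^ 2) = 1 by norm_num, one_pow, one_mul]
          exact one_le_pow₀ (by norm_num)
        calc pure S f x ^ 2 = 1 * pure S f x ^ 2 := (one_mul _).symm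
          _ ≤ ((5 / 2 : ℝ) ^ (2 * L) * (2 / 5 : ℝ) ^ (S.card * 2)) * pure S f x ^ 2 :=
              mul_le_mul_of_nonneg_right hkey h0
          _ = _ := by ring
      · rw [if_neg (fun h => hL h.2)]
        positivity
  -- square, Jensen in `b`, and average in `x`
  have hQ2 : ∀ x : ι → Ω, (∑ S : Finset ι, (if S ≠ ∅ ∧ S.card ≤ L then pure S f x ^ 2 else 0)) ^ 2 ≤
      (5 / 2 : ℝ) ^ (4 * L) * avg (fun b : ι → Bool => (noiseT (sgnVec b) (fun y => f y - avg f) x) ^ 4) := by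
    intro x
    have h0 : 0 ≤ ∑ S : Finset ι, (if S ≠ ∅ ∧ S.card ≤ L then pure S f x ^ 2 else 0) :=
      Finset.sum_nonneg fun S _ => by positivity
    calc (∑ S : Finset ι, (if S ≠ ∅ ∧ S.card ≤ L then pure S f x ^ 2 else 0)) ^ 2
        ≤ ((5 / 2 : ℝ) ^ (2 * L) * avg (fun b : ι → Bool => (∑ S, hc x S * walsh S b) ^ 2)) ^ 2 :=
          pow_le_pow_left₀ h0 (hQ x) 2
      _ = (5 / 2 : ℝ) ^ (4 * L) * (avg (fun b : ι → Bool => (∑ S, hc x S * walsh S b) ^ 2)) ^ 2 := by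
          rw [mul_pow, ← pow_mul]; ring_nf
      _ ≤ (5 / 2 : ℝ) ^ (4 * L) * avg (fun b : ι → Bool => ((∑ S, hc x S * walsh S b) ^ 2) ^ 2) :=
          mul_le_mul_of_nonneg_left (sq_avg_le _) (by positivity)
      _ = (5 / 2 : ℝ) ^ (4 * L) * avg (fun b : ι → Bool => (noiseT (sgnVec b) (fun y => f y - avg f) x) ^ 4) := by
          congr 1
          exact avg_congr fun b => by rw [hH x b]; ring
  calc _ ≤ avg (fun x : ι → Ω => (5 / 2 : ℝ) ^ (4 * L) *
        avg (fun b : ι → Bool => (noiseT (sgnVec b) (fun y => f y - avg f) x) ^ 4)) := avg_mono hQ2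
    _ = (5 / 2 : ℝ) ^ (4 * L) * avg (fun b : ι → Bool =>
        avg (fun x : ι → Ω => (noiseT (sgnVec b) (fun y => f y - avg f) x) ^ 4)) := by
        rw [avg_mul_left, ← avg_prod (fun (x : ι → Ω) (b : ι → Bool) =>
          (noiseT (sgnVec b) (fun y => f y - avg f) x) ^ 4),
          avg_prod_comm (fun (x : ι → Ω) (b : ι → Bool) => (noiseT (sgnVec b) (fun y => f y - avg f) x) ^ 4)]
    _ ≤ (5 / 2 : ℝ) ^ (4 * L) * avg (fun _b : ι → Bool => avg (fun x : ι → Ω => (f x - avg f) ^ 4)) :=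
        mul_le_mul_of_nonneg_left (avg_mono fun b => avg_pow_four_noiseT_le (sgnVec_adm b) _) (by positivity)
    _ = (5 / 2 : ℝ) ^ (4 * L) * avg (fun x : ι → Ω => (f x - avg f) ^ 4) := by rw [avg_const]
    _ ≤ (5 / 2 : ℝ) ^ (4 * L) * (4 * variance f) :=
        mul_le_mul_of_nonneg_left (avg_pow_four_sub_avg_le f hf) (by positivity)
    _ ≤ 40 ^ L * (4 * totalInfl f) := by
        apply mul_le_mul _ _ (by linarith [variance_nonneg f]) (by positivity)
        · rw [pow_mul]; exact pow_le_pow_left₀ (by norm_num) (by norm_num) L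
        · linarith [variance_le_totalInfl f]
    _ = 4 * 40 ^ L * totalInfl f := by ring

/-- **(10.25)–(10.26)** (O'Donnell 2014): on the event that the notable set is too big, the whole
low-level energy is small in expectation:
`E_x[1[|J'_x| ≥ B] ∑_{0<|S|≤L} f^{=S}(x)²] ≤ 2 I[f] √(40^L/(B δ³))` (Cauchy–Schwarz with (10.27),
(10.28)). [cite: ODonnell2014, (10.25)] -/
theorem energy_big_le (f : (ι → Ω) → ℝ) (hf : ∀ x, f x = 1 ∨ f x = -1) (L : ℕ) {δ B : ℝ}
    (hδ : 0 < δ) (hB : 0 < B) :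
    avg (fun x : ι → Ω => (if B ≤ ((notable f δ x).card : ℝ) then (1 : ℝ) else 0) *
      ∑ S : Finset ι, (if S ≠ ∅ ∧ S.card ≤ L then pure S f x ^ 2 else 0)) ≤
      2 * totalInfl f * Real.sqrt (40 ^ L / (B * δ ^ 3)) := by
  have hI0 : 0 ≤ totalInfl f := totalInfl_nonneg f
  have hCS := avg_mul_le_sqrt (fun x : ι → Ω => if B ≤ ((notable f δ x).card : ℝ) then (1 : ℝ) else 0)
    (fun x : ι → Ω => ∑ S : Finset ι, (if S ≠ ∅ ∧ S.card ≤ L then pure S f x ^ 2 else 0))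
  refine hCS.trans ?_
  have h1 : avg (fun x : ι → Ω => (if B ≤ ((notable f δ x).card : ℝ) then (1 : ℝ) else 0) ^ 2) ≤
      totalInfl f / (B * δ ^ 3) := by
    refine (avg_mono fun x => ?_).trans (avg_indicator_big_le f hδ hB)
    split_ifs <;> simp
  have h2 := avg_sq_lowlevel_energy_le f hf L
  calc Real.sqrt (avg fun x : ι → Ω => (if B ≤ ((notable f δ x).card : ℝ) then (1 : ℝ) else 0) ^ 2) *
        Real.sqrt (avg fun x : ι → Ω => (∑ S : Finset ι, (if S ≠ ∅ ∧ S.card ≤ L then pure S f x ^ 2 else 0)) ^ 2)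
      ≤ Real.sqrt (totalInfl f / (B * δ ^ 3)) * Real.sqrt (4 * 40 ^ L * totalInfl f) :=
        mul_le_mul (Real.sqrt_le_sqrt h1) (Real.sqrt_le_sqrt h2) (Real.sqrt_nonneg _) (Real.sqrt_nonneg _)
    _ = 2 * totalInfl f * Real.sqrt (40 ^ L / (B * δ ^ 3)) := by
        rw [← Real.sqrt_mul (by positivity)]
        have e : totalInfl f / (B * δ ^ 3) * (4 * 40 ^ L * totalInfl f) =
            (2 * totalInfl f) ^ 2 * (40 ^ L / (B * δ ^ 3)) := by ring
        rw [e, Real.sqrt_mul (by positivity), Real.sqrt_sq (by positivity)]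

/-! ### Theorem 10.47 in energy form -/

/-- The family `F_x = {S ⊆ J_x : |S| ≤ L}` with `J_x = J'_x` unless `|J'_x| ≥ B`, in which case
`J_x = ∅` (O'Donnell 2014, Thm. 10.47). [cite: ODonnell2014, Theorem 10.47] -/
def goodFamily (f : (ι → Ω) → ℝ) (δ B : ℝ) (L : ℕ) (x : ι → Ω) : Finset (Finset ι) :=
  (if B ≤ ((notable f δ x).card : ℝ) then (∅ : Finset ι) else notable f δ x).powerset.filter
    fun S => S.card ≤ L

omit [Nonempty Ω] in
/-- `∅ ∈ F_x`. [cite: ODonnell2014, Theorem 10.47] -/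
theorem empty_mem_goodFamily (f : (ι → Ω) → ℝ) (δ B : ℝ) (L : ℕ) (x : ι → Ω) :
    ∅ ∈ goodFamily f δ B L x := by
  unfold goodFamily
  simp

omit [Nonempty Ω] in
/-- Members of `F_x` have at most `L` elements. [cite: ODonnell2014, Theorem 10.47] -/
theorem card_le_of_mem_goodFamily {f : (ι → Ω) → ℝ} {δ B : ℝ} {L : ℕ} {x : ι → Ω} {S : Finset ι}
    (hS : S ∈ goodFamily f δ B L x) : S.card ≤ L := (Finset.mem_filter.1 hS).2

omit [Nonempty Ω] in
/-- `|F_x| ≤ 2^B` when `B` is a natural number. [cite: ODonnell2014, Theorem 10.47] -/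
theorem card_goodFamily_le (f : (ι → Ω) → ℝ) (δ : ℝ) (B L : ℕ) (x : ι → Ω) :
    ((goodFamily f δ B L x).card : ℝ) ≤ 2 ^ B := by
  unfold goodFamily
  have hJ : (if (B : ℝ) ≤ ((notable f δ x).card : ℝ) then (∅ : Finset ι) else notable f δ x).card ≤ B := by
    split_ifs with h
    · simp
    · exact_mod_cast (not_le.1 h).le
  calc (((if (B : ℝ) ≤ ((notable f δ x).card : ℝ) then (∅ : Finset ι) else notable f δ x).powerset.filter
        fun S => S.card ≤ L).card : ℝ)
      ≤ ((if (B : ℝ) ≤ ((notable f δ x).card : ℝ) then (∅ : Finset ι) else notable f δ x).powerset.card : ℝ) := by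
        exact_mod_cast Finset.card_filter_le _ _
    _ = 2 ^ (if (B : ℝ) ≤ ((notable f δ x).card : ℝ) then (∅ : Finset ι) else notable f δ x).card := by
        rw [Finset.card_powerset]; push_cast; ring
    _ ≤ 2 ^ B := pow_le_pow_right₀ (by norm_num) hJ

/-- **Theorem 10.47 (energy form)** (O'Donnell 2014): the energy outside the families `F_x` is
controlled by the three terms — tail beyond level `L`, (10.24), and (10.25):
`E_x ∑_{S ∉ F_x} f^{=S}(x)² ≤ I/(L+1) + 20^L δ I + 2 I √(40^L/(Bδ³))`. [cite: ODonnell2014, Theorem 10.47] -/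
theorem energy_outside_family_le (f : (ι → Ω) → ℝ) (hf : ∀ x, f x = 1 ∨ f x = -1) (L : ℕ)
    {δ B : ℝ} (hδ : 0 < δ) (hB : 0 < B) :
    avg (fun x : ι → Ω => ∑ S : Finset ι, (if S ∈ goodFamily f δ B L x then 0 else pure S f x ^ 2)) ≤
      totalInfl f / (L + 1) + 20 ^ L * δ * totalInfl f + 2 * totalInfl f * Real.sqrt (40 ^ L / (B * δ ^ 3)) := by
  -- pointwise three-way split
  have hpt : ∀ (x : ι → Ω) (S : Finset ι), (if S ∈ goodFamily f δ B L x then 0 else pure S f x ^ 2) ≤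
      (if L < S.card then pure S f x ^ 2 else 0) +
      (if S.card ≤ L ∧ ¬ S ⊆ notable f δ x then pure S f x ^ 2 else 0) +
      (if B ≤ ((notable f δ x).card : ℝ) then (1 : ℝ) else 0) *
        (if S ≠ ∅ ∧ S.card ≤ L then pure S f x ^ 2 else 0) := by
    intro x S
    have h0 : 0 ≤ pure S f x ^ 2 := sq_nonneg _
    by_cases hS : S ∈ goodFamily f δ B L x
    · rw [if_pos hS]; positivity
    · rw [if_neg hS]
      unfold goodFamily at hS
      rw [Finset.mem_filter, Finset.mem_powerset, not_and_or] at hS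
      by_cases hL : L < S.card
      · rw [if_pos hL]
        have : 0 ≤ (if S.card ≤ L ∧ ¬ S ⊆ notable f δ x then pure S f x ^ 2 else 0) +
            (if B ≤ ((notable f δ x).card : ℝ) then (1 : ℝ) else 0) *
              (if S ≠ ∅ ∧ S.card ≤ L then pure S f x ^ 2 else 0) := by positivity
        linarith
      · have hL' : S.card ≤ L := not_lt.1 hL
        rw [if_neg hL]
        rcases hS with hS | hS
        · by_cases hbig : B ≤ ((notable f δ x).card : ℝ)
          · rw [if_pos hbig] at hS
            simp only [Finset.subset_empty] at hS
            rw [if_pos hbig, if_pos (show S ≠ ∅ ∧ S.card ≤ L from ⟨hS, hL'⟩)]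
            have : 0 ≤ (if S.card ≤ L ∧ ¬ S ⊆ notable f δ x then pure S f x ^ 2 else 0) := by positivity
            linarith
          · rw [if_neg hbig] at hS
            rw [if_pos (show S.card ≤ L ∧ ¬ S ⊆ notable f δ x from ⟨hL', hS⟩)]
            have : 0 ≤ (if B ≤ ((notable f δ x).card : ℝ) then (1 : ℝ) else 0) *
                (if S ≠ ∅ ∧ S.card ≤ L then pure S f x ^ 2 else 0) := by positivity
            linarith
        · exact absurd hL' hS
  have htail : avg (fun x : ι → Ω => ∑ S : Finset ι, (if L < S.card then pure S f x ^ 2 else 0)) ≤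
      totalInfl f / (L + 1) := by
    rw [avg_finset_sum]
    have := sum_filter_card_gt_le f L
    rw [Finset.sum_filter] at this
    refine (le_of_eq ?_).trans this
    refine Finset.sum_congr rfl fun S _ => ?_
    split_ifs
    · rfl
    · exact avg_zero
  calc _ ≤ avg (fun x : ι → Ω => ∑ S : Finset ι, ((if L < S.card then pure S f x ^ 2 else 0) +
        (if S.card ≤ L ∧ ¬ S ⊆ notable f δ x then pure S f x ^ 2 else 0) +
        (if B ≤ ((notable f δ x).card : ℝ) then (1 : ℝ) else 0) *
          (if S ≠ ∅ ∧ S.card ≤ L then pure S f x ^ 2 else 0))) :=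
        avg_mono fun x => Finset.sum_le_sum fun S _ => hpt x S
    _ = avg (fun x : ι → Ω => ∑ S : Finset ι, (if L < S.card then pure S f x ^ 2 else 0)) +
        avg (fun x : ι → Ω => ∑ S : Finset ι, (if S.card ≤ L ∧ ¬ S ⊆ notable f δ x then pure S f x ^ 2 else 0)) +
        avg (fun x : ι → Ω => (if B ≤ ((notable f δ x).card : ℝ) then (1 : ℝ) else 0) *
          ∑ S : Finset ι, (if S ≠ ∅ ∧ S.card ≤ L then pure S f x ^ 2 else 0)) := by
        rw [← avg_add, ← avg_add]
        refine avg_congr fun x => ?_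
        rw [Finset.sum_add_distrib, Finset.sum_add_distrib, Finset.mul_sum]
    _ ≤ _ := add_le_add_three htail (level_energy_outside_notable_le f hf L hδ.le) (energy_big_le f hf L hδ hB)

/-! ### From energy inside the families to boosters -/

/-- Numerical facts for the constants: `2 L ≤ 5^L` and `4 L ≤ 20^L`. [folklore] -/
theorem two_mul_le_five_pow (L : ℕ) : 2 * (L : ℝ) ≤ 5 ^ L ∧ 4 * (L : ℝ) ≤ 20 ^ L := by
  induction L with
  | zero => norm_num
  | succ n ih =>
    obtain ⟨h1, h2⟩ := ih
    have h5 : (1 : ℝ) ≤ 5 ^ n := one_le_pow₀ (by norm_num)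
    have h20 : (1 : ℝ) ≤ 20 ^ n := one_le_pow₀ (by norm_num)
    constructor
    · push_cast; rw [pow_succ]; nlinarith
    · push_cast; rw [pow_succ]; nlinarith

/-- **Theorem 10.47 with the constants of Bourgain's theorem** (O'Donnell 2014): for `±1`-valued
`f` with `I[f] ≤ K`, `Var f ≥ v₀ > 0`, `L = ⌈4K/v₀⌉`, `δ = 100^{-L}`, `B = (1.6·10^{10})^L`, the
energy inside the families is large: `E_x ∑_{S ∈ F_x, S ≠ ∅} f^{=S}(x)² ≥ v₀/2`.
[cite: ODonnell2014, Theorem 10.47] -/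
theorem energy_inside_family_ge (f : (ι → Ω) → ℝ) (hf : ∀ x, f x = 1 ∨ f x = -1) {K v0 : ℝ}
    (hv0 : 0 < v0) (hI : totalInfl f ≤ K) (hvar : v0 ≤ variance f) :
    v0 / 2 ≤ avg (fun x : ι → Ω => ∑ S ∈ (goodFamily f ((1 / 100 : ℝ) ^ ⌈4 * K / v0⌉₊)
      ((16000000000 : ℝ) ^ ⌈4 * K / v0⌉₊) ⌈4 * K / v0⌉₊ x).erase ∅, pure S f x ^ 2) := by
  set L : ℕ := ⌈4 * K / v0⌉₊ with hL
  set δ : ℝ := (1 / 100 : ℝ) ^ L with hδ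
  set B : ℝ := (16000000000 : ℝ) ^ L with hB
  have hδ0 : 0 < δ := by positivity
  have hB0 : 0 < B := by positivity
  have hI0 : 0 ≤ totalInfl f := totalInfl_nonneg f
  have hKv : v0 ≤ K := hvar.trans ((variance_le_totalInfl f).trans hI)
  have hK0 : 0 < K := hv0.trans_le hKv
  have hLge : 4 * K / v0 ≤ L := by rw [hL]; exact Nat.le_ceil _
  have hLge' : 4 * K ≤ v0 * L := by
    have := (div_le_iff₀ hv0).1 hLge; linarith
  obtain ⟨h5L, h20L⟩ := two_mul_le_five_pow L
  -- the three error terms are each small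
  have hout := energy_outside_family_le f hf L hδ0 hB0
  have ht1 : totalInfl f / (L + 1) ≤ v0 / 4 := by
    rw [div_le_iff₀ (by positivity)]
    nlinarith
  have ht2 : 20 ^ L * δ * totalInfl f ≤ v0 / 8 := by
    have e : (20 : ℝ) ^ L * δ = 1 / 5 ^ L := by
      rw [hδ, ← mul_pow, show (20 : ℝ) * (1 / 100) = 1 / 5 by norm_num, one_div_pow]
    rw [e]
    have h5 : (0 : ℝ) < 5 ^ L := by positivity
    rw [div_mul_eq_mul_div, one_mul, div_le_iff₀ h5]
    nlinarith
  have ht3 : 2 * totalInfl f * Real.sqrt (40 ^ L / (B * δ ^ 3)) ≤ v0 / 8 := by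
    have e : (40 : ℝ) ^ L / (B * δ ^ 3) = ((1 / 20 : ℝ) ^ L) ^ 2 := by
      rw [hB, hδ, ← pow_mul, mul_comm L 3, pow_mul, ← mul_pow, ← div_pow, ← pow_mul, mul_comm L 2,
        pow_mul]
      norm_num
    rw [e, Real.sqrt_sq (by positivity), one_div_pow]
    have h20 : (0 : ℝ) < 20 ^ L := by positivity
    rw [mul_one_div, div_le_iff₀ h20]
    nlinarith
  -- total energy `1`, energy of `∅` at most `1 - v0`
  have htot : avg (fun x : ι → Ω => ∑ S : Finset ι, pure S f x ^ 2) = 1 := by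
    rw [avg_finset_sum, ← avg_sq_eq_sum]
    have : (fun x => f x ^ 2) = fun _ => (1 : ℝ) := by
      funext x; rcases hf x with h | h <;> simp [h]
    rw [this, avg_const]
  have hempty : ∀ x : ι → Ω, pure ∅ f x ^ 2 ≤ 1 - v0 := by
    intro x
    rw [pure_empty]
    have : variance f = 1 - avg f ^ 2 := by
      unfold variance
      have : (fun x => f x ^ 2) = fun _ => (1 : ℝ) := by
        funext x; rcases hf x with h | h <;> simp [h]
      rw [this, avg_const]
    linarith
  -- split the total energy
  have hsplit : ∀ x : ι → Ω, ∑ S : Finset ι, pure S f x ^ 2 =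
      ∑ S ∈ (goodFamily f δ B L x).erase ∅, pure S f x ^ 2 + pure ∅ f x ^ 2 +
      ∑ S : Finset ι, (if S ∈ goodFamily f δ B L x then 0 else pure S f x ^ 2) := by
    intro x
    rw [Finset.sum_erase_add _ _ (empty_mem_goodFamily f δ B L x)]
    rw [← Finset.sum_filter_add_sum_filter_not Finset.univ (fun S => S ∈ goodFamily f δ B L x)]
    congr 1
    · apply Finset.sum_congr _ (fun _ _ => rfl)
      ext S; simp
    · rw [Finset.sum_filter]
      refine Finset.sum_congr rfl fun S _ => ?_
      split_ifs <;> rfl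
  have key : avg (fun x : ι → Ω => ∑ S ∈ (goodFamily f δ B L x).erase ∅, pure S f x ^ 2) =
      1 - avg (fun x : ι → Ω => pure ∅ f x ^ 2) -
        avg (fun x : ι → Ω => ∑ S : Finset ι, (if S ∈ goodFamily f δ B L x then 0 else pure S f x ^ 2)) := by
    rw [← htot, show (fun x : ι → Ω => ∑ S : Finset ι, pure S f x ^ 2) = fun x =>
      ∑ S ∈ (goodFamily f δ B L x).erase ∅, pure S f x ^ 2 + pure ∅ f x ^ 2 +
      ∑ S : Finset ι, (if S ∈ goodFamily f δ B L x then 0 else pure S f x ^ 2) from funext hsplit,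
      avg_add, avg_add]
    ring
  rw [key]
  have h1 : avg (fun x : ι → Ω => pure ∅ f x ^ 2) ≤ 1 - v0 := avg_le_of_le hempty
  linarith

/-- **Bourgain's sharp threshold theorem** (O'Donnell 2014, §10.5; Bourgain 1999, Prop. 1), for the
uniform measure on a finite product `ι → Ω`, with explicit constants: for every `K` and `v₀ > 0`
there are `τ > 0` and `L = ⌈4K/v₀⌉` (depending only on `K, v₀`) such that every `±1`-valued `f`
with `I[f] ≤ K` and `Var[f] ≥ v₀` has, with probability at least `τ` over a uniform `x`, a set `T`
of at most `L` coordinates for which the restriction `x_T` is a `τ`-booster of a definite sign: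
either `P_x[∃ T, |T| ≤ L, f^{⊆T}(x) ≥ E f + τ] ≥ τ` or `P_x[∃ T, |T| ≤ L, f^{⊆T}(x) ≤ E f - τ] ≥ τ`.
(The printed `Var[f] ≥ .01`, `|τ| ≥ exp(-O(K²))`, `|T| ≤ O(K)` become `v₀`, the explicit `τ`
below, and `⌈4K/v₀⌉`.) [cite: ODonnell2014, §10.5 (Bourgain's Sharp Threshold Theorem)] -/
theorem bourgain_sharp_threshold (K v0 : ℝ) (hv0 : 0 < v0) :
    ∃ τ : ℝ, 0 < τ ∧ ∀ {ι : Type*} {Ω : Type*} [Fintype ι] [DecidableEq ι] [Fintype Ω] [Nonempty Ω]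
      (f : (ι → Ω) → ℝ), (∀ x, f x = 1 ∨ f x = -1) → totalInfl f ≤ K → v0 ≤ variance f →
      τ ≤ avg (fun x : ι → Ω =>
        if ∃ T : Finset ι, T.card ≤ ⌈4 * K / v0⌉₊ ∧ τ ≤ proj T f x - avg f then (1 : ℝ) else 0) ∨
      τ ≤ avg (fun x : ι → Ω =>
        if ∃ T : Finset ι, T.card ≤ ⌈4 * K / v0⌉₊ ∧ τ ≤ avg f - proj T f x then (1 : ℝ) else 0) := by
  set L : ℕ := ⌈4 * K / v0⌉₊ with hL
  -- the constants
  set Nmax : ℝ := (2 : ℝ) ^ ((16000000000 : ℕ) ^ L) with hNmax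
  set θ : ℝ := v0 / (2 * Nmax) with hθ
  set τ1 : ℝ := Real.sqrt (θ / 2) / 2 ^ L with hτ1
  set p1 : ℝ := θ / (2 * 4 ^ L) with hp1
  have hNmax0 : 0 < Nmax := by positivity
  have hθ0 : 0 < θ := by positivity
  have hτ10 : 0 < τ1 := by positivity
  have hp10 : 0 < p1 := by positivity
  refine ⟨min τ1 (p1 / 2), lt_min hτ10 (by positivity), ?_⟩
  intro ι Ω _ _ _ _ f hf hI hvar
  set δ : ℝ := (1 / 100 : ℝ) ^ L with hδ
  set B : ℝ := (16000000000 : ℝ) ^ L with hB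
  have hBnat : B = ((16000000000 : ℕ) ^ L : ℕ) := by rw [hB]; push_cast; ring
  -- Step 1: energy inside the families
  have hE := energy_inside_family_ge f hf hv0 hI hvar
  rw [← hL] at hE
  change v0 / 2 ≤ avg (fun x : ι → Ω => ∑ S ∈ (goodFamily f δ B L x).erase ∅, pure S f x ^ 2) at hE
  -- Step 2: the maximal term `M_x`
  set Mx : (ι → Ω) → ℝ := fun x =>
    if h : ((goodFamily f δ B L x).erase ∅).Nonempty then
      ((goodFamily f δ B L x).erase ∅).sup' h (fun S => pure S f x ^ 2) else 0 with hMx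
  have hMx0 : ∀ x, 0 ≤ Mx x := by
    intro x
    simp only [hMx]
    split_ifs with h
    · obtain ⟨S, hS⟩ := h
      exact (sq_nonneg (pure S f x)).trans (Finset.le_sup' (fun S => pure S f x ^ 2) hS)
    · exact le_rfl
  have hsum_le : ∀ x : ι → Ω, ∑ S ∈ (goodFamily f δ B L x).erase ∅, pure S f x ^ 2 ≤ Nmax * Mx x := by
    intro x
    by_cases h : ((goodFamily f δ B L x).erase ∅).Nonempty
    · calc ∑ S ∈ (goodFamily f δ B L x).erase ∅, pure S f x ^ 2
          ≤ ∑ _S ∈ (goodFamily f δ B L x).erase ∅, Mx x := by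
            refine Finset.sum_le_sum fun S hS => ?_
            simp only [hMx, dif_pos h]
            exact Finset.le_sup' (fun S => pure S f x ^ 2) hS
        _ = ((goodFamily f δ B L x).erase ∅).card * Mx x := by rw [Finset.sum_const, nsmul_eq_mul]
        _ ≤ Nmax * Mx x := by
            apply mul_le_mul_of_nonneg_right _ (hMx0 x)
            calc (((goodFamily f δ B L x).erase ∅).card : ℝ) ≤ (goodFamily f δ B L x).card := by
                  exact_mod_cast Finset.card_erase_le
              _ ≤ Nmax := by
                  rw [hNmax]
                  have := card_goodFamily_le f δ ((16000000000 : ℕ) ^ L) L x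
                  push_cast at this
                  rw [hB]
                  exact this
    · rw [Finset.not_nonempty_iff_eq_empty.1 h, Finset.sum_empty]
      exact mul_nonneg hNmax0.le (hMx0 x)
  have hEM : θ ≤ avg Mx := by
    have h1 : v0 / 2 ≤ Nmax * avg Mx := by
      rw [← avg_mul_left]
      exact hE.trans (avg_mono hsum_le)
    rw [hθ, div_le_iff₀ (by positivity)]
    linarith
  -- Step 3: `M_x ≤ 4^L`, so `P[M_x ≥ θ/2] ≥ p1`
  have hMxle : ∀ x, Mx x ≤ 4 ^ L := by
    intro x
    simp only [hMx]
    split_ifs with h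
    · apply Finset.sup'_le
      intro S hS
      have hSL : S.card ≤ L := card_le_of_mem_goodFamily (Finset.mem_of_mem_erase hS)
      have habs : |pure S f x| ≤ 2 ^ S.card * 1 :=
        abs_pure_le S (fun y => by rcases hf y with h | h <;> simp [h]) x
      calc pure S f x ^ 2 ≤ (2 ^ S.card) ^ 2 := by
            rw [mul_one] at habs
            exact sq_le_sq' (by linarith [abs_le.1 habs]) (abs_le.1 habs).2
        _ = 4 ^ S.card := by rw [← pow_mul, mul_comm, pow_mul]; norm_num
        _ ≤ 4 ^ L := pow_le_pow_right₀ (by norm_num) hSL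
    · positivity
  have hP1 : p1 ≤ avg (fun x : ι → Ω => if θ / 2 ≤ Mx x then (1 : ℝ) else 0) := by
    have hpt : ∀ x, Mx x ≤ θ / 2 + 4 ^ L * (if θ / 2 ≤ Mx x then (1 : ℝ) else 0) := by
      intro x
      split_ifs with h
      · have := hMxle x; linarith [hθ0]
      · push Not at h; have : (0 : ℝ) ≤ 4 ^ L := by positivity
        linarith
    have h := hEM.trans (avg_mono hpt)
    rw [avg_add, avg_const, avg_mul_left] at h
    rw [hp1, div_le_iff₀ (by positivity)]
    linarith
  -- Step 4: on `{M_x ≥ θ/2}` there is a booster `T` with `|T| ≤ L`, `|f^{⊆T}(x) - Ef| ≥ τ1`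
  have hboost : ∀ x : ι → Ω, θ / 2 ≤ Mx x →
      ∃ T : Finset ι, T.card ≤ L ∧ τ1 ≤ |proj T f x - avg f| := by
    intro x hx
    have hne : ((goodFamily f δ B L x).erase ∅).Nonempty := by
      by_contra h
      simp only [hMx, dif_neg h] at hx
      linarith
    simp only [hMx, dif_pos hne] at hx
    obtain ⟨S, hS, hSmax⟩ := Finset.exists_mem_eq_sup' hne (fun S => pure S f x ^ 2)
    rw [hSmax] at hx
    have hSne : S ≠ ∅ := Finset.ne_of_mem_erase hS
    have hSL : S.card ≤ L := card_le_of_mem_goodFamily (Finset.mem_of_mem_erase hS)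
    -- `|g^{=S}(x)| ≥ √(θ/2)` for `g = f - Ef`
    set g : (ι → Ω) → ℝ := fun y => f y - avg f with hg
    have hg0 : avg g = 0 := by rw [hg, avg_sub, avg_const, sub_self]
    have hgS : pure S g x = pure S f x := pure_sub_avg (Finset.nonempty_iff_ne_empty.2 hSne) f x
    have habs : Real.sqrt (θ / 2) ≤ |pure S g x| := by
      rw [hgS, ← Real.sqrt_sq_eq_abs]
      exact Real.sqrt_le_sqrt hx
    -- expand over nonempty `T ⊆ S`
    rw [pure_eq_sum_filter_nonempty S hg0 x] at habs
    by_contra hcon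
    push Not at hcon
    have hlt : ∀ T ∈ S.powerset.filter (fun T => T ≠ ∅),
        |(-1 : ℝ) ^ (S.card + T.card) * proj T g x| < τ1 := by
      intro T hT
      have hTS : T ⊆ S := Finset.mem_powerset.1 (Finset.mem_filter.1 hT).1
      rw [abs_mul, abs_pow, abs_neg, abs_one, one_pow, one_mul]
      have e : proj T g x = proj T f x - avg f := by
        rw [hg, proj_sub, proj_const]
      rw [e]
      exact hcon T ((Finset.card_le_card hTS).trans hSL)
    have hcard : ((S.powerset.filter (fun T => T ≠ ∅)).card : ℝ) ≤ 2 ^ L := by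
      calc ((S.powerset.filter (fun T => T ≠ ∅)).card : ℝ) ≤ S.powerset.card := by
            exact_mod_cast Finset.card_filter_le _ _
        _ = 2 ^ S.card := by rw [Finset.card_powerset]; push_cast; ring
        _ ≤ 2 ^ L := pow_le_pow_right₀ (by norm_num) hSL
    have hsumlt : |∑ T ∈ S.powerset.filter (fun T => T ≠ ∅), (-1 : ℝ) ^ (S.card + T.card) * proj T g x| <
        2 ^ L * τ1 := by
      by_cases hempty : (S.powerset.filter (fun T => T ≠ ∅)) = ∅
      · rw [hempty, Finset.sum_empty, abs_zero]; positivity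
      calc |∑ T ∈ S.powerset.filter (fun T => T ≠ ∅), (-1 : ℝ) ^ (S.card + T.card) * proj T g x|
          ≤ ∑ T ∈ S.powerset.filter (fun T => T ≠ ∅), |(-1 : ℝ) ^ (S.card + T.card) * proj T g x| :=
            Finset.abs_sum_le_sum_abs _ _
        _ < ∑ _T ∈ S.powerset.filter (fun T => T ≠ ∅), τ1 :=
            Finset.sum_lt_sum_of_nonempty (Finset.nonempty_iff_ne_empty.2 hempty) hlt
        _ = (S.powerset.filter (fun T => T ≠ ∅)).card * τ1 := by rw [Finset.sum_const, nsmul_eq_mul]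
        _ ≤ 2 ^ L * τ1 := mul_le_mul_of_nonneg_right hcard hτ10.le
    have : 2 ^ L * τ1 = Real.sqrt (θ / 2) := by
      rw [hτ1]; field_simp
    linarith
  -- Step 5: probability of a booster of either sign, then split by sign
  have hPboth : p1 ≤ avg (fun x : ι → Ω =>
      if ∃ T : Finset ι, T.card ≤ L ∧ τ1 ≤ |proj T f x - avg f| then (1 : ℝ) else 0) := by
    refine hP1.trans (avg_mono fun x => ?_)
    split_ifs with h1 h2
    · exact le_rfl
    · exact absurd (hboost x h1) h2
    · positivity
    · exact le_rfl
  have hsplit : ∀ x : ι → Ω,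
      (if ∃ T : Finset ι, T.card ≤ L ∧ τ1 ≤ |proj T f x - avg f| then (1 : ℝ) else 0) ≤
      (if ∃ T : Finset ι, T.card ≤ L ∧ min τ1 (p1 / 2) ≤ proj T f x - avg f then (1 : ℝ) else 0) +
      (if ∃ T : Finset ι, T.card ≤ L ∧ min τ1 (p1 / 2) ≤ avg f - proj T f x then (1 : ℝ) else 0) := by
    intro x
    split_ifs with h1 h2 h3 h3 <;> norm_num
    obtain ⟨T, hT, hTτ⟩ := h1
    rcases le_abs'.1 hTτ with h | h
    · exact h3 ⟨T, hT, (min_le_left _ _).trans (by linarith)⟩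
    · exact h2 ⟨T, hT, (min_le_left _ _).trans h⟩
  have hfin := hPboth.trans (avg_mono hsplit)
  rw [avg_add] at hfin
  by_cases hpos : p1 / 2 ≤ avg (fun x : ι → Ω =>
      if ∃ T : Finset ι, T.card ≤ L ∧ min τ1 (p1 / 2) ≤ proj T f x - avg f then (1 : ℝ) else 0)
  · left; exact (min_le_right _ _).trans hpos
  · right
    push Not at hpos
    exact (min_le_right _ _).trans (by linarith)

end ProductSpace

end Literature.Computability.Complexity

end
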